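import Summits.Schanuel.Schanuel.Theorems.RootDecomp1KCollarCell04

/-!
# RootDecomp1KCollarCell — lens 1, generation 48, node 7 «THE COLLAR CELL: skeleton-RESONANT dyadic approximants are never level points (2-adic interlacing, all P, m-free), with a certified member of EXACT Skel-order m» (CLAIM L2417, EX-ANTE PRICE + CHECKLIST K-g48 L2418, NODE L2431 / REQUEST L2432; critic VERDICT L2435: CLEARED AS PRICED — ONE CELL ×1 «DYADIC COLLAR», RULE K-R37, PORT GO) — continuation (RootDecomp1KCollarCell05): §4 certificates M1–M5, exact order, non-membership in every decided class

(lens-1 g48 HOME kernel K = HOME/decomp-schanuel-lens-1/g48/CollarCell.lean f82e9183…, 1281 l, imports …RootDecomp1KDegreeLadder05 + …RootDecomp1KDarkLogSq04 BY NAME; P CollarCellProbe.lean 50792f78… rc 0 / C CollarCellCtrl.lean 9aabc182… rc 1 = 14 planted; memo NODE-g48.md; NODE L2431 / REQUEST L2432. Port by census-1 gen 21 as `RootDecomp1KCollarCell01–06` along K's §1–§5 with §3 cut in two by the 400-line file cap: 01 = §1 (T1) the 2-adic interlacing lemma `twoAdic_bev_ne_zero` with `maxval₂`, `weights_injective`;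 02 = §2 the class `DyadicCollarLiouville` («[class] definition» tag) and its engine `bev_ne_zero_of_collar` (T2), `algebraicIndependent_ell2_of_collar` (T3), `statement_b_on_collar_ge_one`, `not_dyadicCollarLiouville_uStar`, `sb_collarPair` / `coordLiouvilleSchanuel_collarPair` (T4, item 31077's binders verbatim at n = 2, whole class, hyp-free); 03 = §3a the run pattern `Nn`/`fN`/`gN`, increments `aN`, `rhoNat`, tails `tailN`; 04 = §3b numerators `MN`, truncations `tN`, overshoots `uN`/`UN`, `iota_two_pow_fN`, `rhoNat_ne_tN`; 05 = §4 certificates M1 `dyadicCollarLiouville_rhoNat`, M2 `skelLiouvilleFix_rhoNat`, cover `rhoNat_cover`, M3 `not_skelLiouvilleFix_succ_rhoNat` / `not_skelLiouville_rhoNat`, M4 `not_factorialGapLiouville_rhoNat`, M5 `not_logLogLiouville_rhoNat` + `not_logSqLiouville_rhoNat` / `not_logHyperLiouville_rhoNat` / `not_hyperLiouville_rhoNat` / `not_liouvilleOrder_rhoNat`, `liouville_rhoNat`, `dyadicCollarLiouville_not_subset`; 06 = §5 the exhibited tuple `zN2 = (ℓ₂, ρ♮₂)`: `linearIndependent_zN2`,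 `coordLiouvilleSpan_zN2`, `zN2_in_scope_31077`, `sb_zN2`, `coordLiouvilleSchanuel_at_zN2`, `item31077_at_zN2`, `rhoNat_two_profile` — ALL HYP-FREE. PORT EDITS (census convention, as sanctioned for every K-line port): `set_option linter.dupNamespace false` dropped; «[class] definition (membership predicate with parameters, NOT a fact; census convention)» wording on `DyadicCollarLiouville`; 35 one-line helper docstrings added; K's `liouvilleNumber_two_lt` (§2) DELETED in favour of the byte-identical tree decl `RootDecomp1KRelLiouvilleCell.liouvilleNumber_two_lt` (RelLiouvilleCell03, already in the import cone; dedup bounce p838600) — referenced via the §2 `open … (… liouvilleNumber_two_lt)` list; two generic §1 one-liners privatised; per-part private helper copies if any; statements and proofs otherwise verbatim (no renames). `--supports stmt-Schanuel-31077`; no census credit carried; rung 0 — nothing here proves Schanuel; no ∀-item moves; 31077 and 33364 stay OPEN.)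
-/

noncomputable section

open Polynomial LiouvilleNumber
open scoped Nat

namespace Summit.Schanuel.Schanuel.Theorems.RootDecomp1KCollarCell

open Summit.Schanuel.Schanuel.Theorems.RootDecomp1KDegreeLadder
  (bev bev_eq_double_sum xdeg natDegree_coeff_le_xdeg specX aeval_specX natDegree_specX_le
   abs_aeval_ge_of_ne_zero lipschitz_x lipschitz_y algebraicIndependent_of_no_relation)
open Summit.Schanuel.Schanuel.Theorems.RootDecomp1KSkelCell
  (iota iota_spec iota_le_of_le pow_lt_of_lt_iota lt_iota_of_pow_lt iota_mono one_le_iota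
   SkelLiouville SkelLiouvilleFix skelLiouville_iff_fix SkelLiouvilleFix.mono logLogLiouville_skelLiouville)
open Summit.Schanuel.Schanuel.Theorems.RootDecomp1KLogLogCell
  (LogLogLiouville logLogLiouville_of_logSqLiouville logLogLiouville_of_logHyperLiouville
   logLogLiouville_of_hyperLiouville)
open Summit.Schanuel.Schanuel.Theorems.RootDecomp1KGeneric (LogSqLiouville LiouvilleOrder)
open Summit.Schanuel.Schanuel.Theorems.RootDecomp1KRelLiouvilleCell (LogHyperLiouville)
open Summit.Schanuel.Schanuel.Theorems.RootDecomp1KDarkLogSq (logHyperLiouville_of_liouvilleOrder)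
open Summit.Schanuel.Schanuel.Theorems.RootDecomp1KTwoBaseCell
  (psNumer partialSum_eq_psNumer_div coprime_psNumer sb_of_range_eq')
open Summit.Schanuel.Schanuel.Theorems.RootDecomp1KGapCell (FactorialGapLiouville)
open Summit.Schanuel.Schanuel.Theorems.RootDecomp1KHyper
open Summit.Schanuel.Schanuel.Theorems.RootDecomp1KHyper.HyperCell

/-! ## §4  CERTIFICATES: `ρ♮_m ∈ DyadicCollarLiouville ∩ (Skel_m \ Skel_{m+1})`, `ρ♮_m ∉ FactorialGap ∪ LogLog ∪ …` -/
section Certificates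

/-- `N² ≤ N!` for the block indices (`N ≥ 4`). -/
theorem mul_self_le_factorial_Nn (m k : ℕ) : Nn m k * Nn m k ≤ (Nn m k)! := by
  obtain ⟨M, hM⟩ : ∃ M, Nn m k = M + 4 := ⟨m + 2 * k, by unfold Nn; ring⟩
  rw [hM]
  simp only [Nat.factorial_succ]
  have hF : 0 < M ! := Nat.factorial_pos M
  have h1 : 1 ≤ (M + 1) * M ! := Nat.mul_pos (by omega) hF
  have h2 : M + 2 ≤ (M + 2) * ((M + 1) * M !) := Nat.le_mul_of_pos_right _ h1
  have h3 : M + 4 ≤ (M + 3) * ((M + 2) * ((M + 1) * M !)) := by nlinarith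
  exact Nat.mul_le_mul_left _ h3

/-- **M1.** `ρ♮_m ∈ DyadicCollarLiouville` (witness at scale `N_k`, `k := A + K`: `h := N_k`, `t := t_k`,
`den t_k = 2^{N_k! + N_k}`, `|ρ♮ − t_k| = T_k < 2/2^{g_k} ≤ den^{−A}` since `A f_k + 1 ≤ m (N_k+1) f_k + 1 = g_k`). -/
theorem dyadicCollarLiouville_rhoNat {m : ℕ} (hm : 1 ≤ m) : DyadicCollarLiouville (rhoNat m) := by
  intro A K
  refine ⟨Nn m (A + K), by unfold Nn; omega, Nn m (A + K), by unfold Nn; omega, ?_, tN m (A + K), tN_den m _, ?_⟩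
  · exact le_trans (Nat.mul_le_mul_right _ (by unfold Nn; omega)) (mul_self_le_factorial_Nn m (A + K))
  · rw [rhoNat_sub_tN hm, abs_of_pos (tailN_pos hm _), tN_den_cast, ← pow_mul]
    refine (tailN_lt_two_div hm _).trans_le ?_
    rw [div_le_div_iff₀ (by positivity) (by positivity), one_mul, ← pow_succ']
    apply pow_le_pow_right₀ (by norm_num)
    unfold gN
    have hA : A ≤ m * (Nn m (A + K) + 1) := le_trans (by unfold Nn; omega) (Nat.le_mul_of_pos_left _ hm)
    nlinarith [Nat.mul_le_mul_left (fN m (A + K)) hA]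

/-- **M2.** `ρ♮_m ∈ Skel_m` (`SkelLiouvilleFix m`): witnesses `t_k`, `den t_k = 2^{f_k}`, `ι(2^{f_k}) = N_k + 1`,
`den^{m ι} = 2^{g_k − 1}` and `|ρ♮ − t_k| = T_k < 2/2^{g_k}`. -/
theorem skelLiouvilleFix_rhoNat {m : ℕ} (hm : 1 ≤ m) : SkelLiouvilleFix m (rhoNat m) := by
  intro q₀
  refine ⟨tN m q₀, ?_, rhoNat_ne_tN hm q₀, ?_⟩
  · rw [tN_den]
    have h1 := two_mul_le_Nn m q₀
    have h2 := Nn_le_fN m q₀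
    have h3 : fN m q₀ < 2 ^ fN m q₀ := Nat.lt_two_pow_self
    omega
  · rw [rhoNat_sub_tN hm, abs_of_pos (tailN_pos hm _), tN_den, iota_two_pow_fN]
    push_cast
    rw [← pow_mul]
    refine (tailN_lt_two_div hm q₀).trans_le ?_
    rw [div_le_div_iff₀ (by positivity) (by positivity), one_mul, ← pow_succ']
    apply pow_le_pow_right₀ (by norm_num)
    unfold gN
    exact le_of_eq (by ring)

/-- Two distinct rationals are `≥ 1/(den·den')` apart (private copy of the tree helper of
`RootDecomp1KGapCell01` / `RootDecomp1KSkelCell03`, which is `private` there). -/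
private theorem one_div_den_mul_den_le_abs_sub {s r : ℚ} (hne : s ≠ r) :
    1 / ((s.den : ℝ) * r.den) ≤ |(s : ℝ) - r| := by
  have hsd : (0 : ℝ) < s.den := by exact_mod_cast s.den_pos
  have hrd : (0 : ℝ) < r.den := by exact_mod_cast r.den_pos
  set z : ℤ := s.num * r.den - r.num * s.den with hz
  have hsub : (s : ℝ) - r = (z : ℝ) / ((s.den : ℝ) * r.den) := by
    rw [Rat.cast_def s, Rat.cast_def r, hz]
    push_cast
    field_simp
  have hz0 : z ≠ 0 := by
    intro h0
    have : (s : ℝ) - r = 0 := by rw [hsub, h0]; simp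
    exact hne (by exact_mod_cast (sub_eq_zero.mp this))
  have hz1 : (1 : ℝ) ≤ |(z : ℝ)| := by exact_mod_cast Int.one_le_abs hz0
  rw [hsub, abs_div, abs_of_pos (mul_pos hsd hrd)]
  exact div_le_div_of_nonneg_right hz1 (mul_pos hsd hrd).le

/-- **COVERING LEMMA.** Every rational with `den ≥ 2^{f_0}` is a truncation `t_k`, an overshoot `u_k`, or lies
`≥ 1/(8 den⁴)` from `ρ♮_m`.  (Comparison index `k` := the largest with `2^{f_k} ≤ q`; cases (α) `4q² ≤ 2^{g_k}`:
compare with `t_k`; (β) `q 2^{g_k} ≤ 2^{f_{k+1}}`: compare with `u_k`; (γ) otherwise `q > 2^{f_{k+1} − g_k}`: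
compare with `t_{k+1}`, whose denominator exceeds `q`.) -/
theorem rhoNat_cover {m : ℕ} (hm : 1 ≤ m) (r : ℚ) (hr : 2 ^ fN m 0 ≤ r.den) :
    (∃ k, r = tN m k) ∨ (∃ k, r = uN m k) ∨ 1 / (8 * (r.den : ℝ) ^ 4) ≤ |rhoNat m - r| := by
  classical
  have hq1 : 1 ≤ r.den := r.den_pos
  set k := Nat.findGreatest (fun k => 2 ^ fN m k ≤ r.den) r.den with hk
  have hPk : 2 ^ fN m k ≤ r.den :=
    Nat.findGreatest_spec (P := fun k => 2 ^ fN m k ≤ r.den) (Nat.zero_le _) hr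
  have hPk1 : r.den < 2 ^ fN m (k + 1) := by
    by_contra hcon
    push Not at hcon
    by_cases hle : k + 1 ≤ r.den
    · exact Nat.findGreatest_is_greatest (P := fun k => 2 ^ fN m k ≤ r.den) (Nat.lt_succ_self _) hle hcon
    · have h1 : k + 1 ≤ fN m (k + 1) := by
        have := two_mul_le_Nn m (k + 1); have := Nn_le_fN m (k + 1); omega
      have h2 : fN m (k + 1) < 2 ^ fN m (k + 1) := Nat.lt_two_pow_self
      omega
  have hQ : (2 : ℝ) ^ fN m k ≤ r.den := by exact_mod_cast hPk
  have hQ1 : (r.den : ℝ) < (2 : ℝ) ^ fN m (k + 1) := by exact_mod_cast hPk1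
  have hqR : (1 : ℝ) ≤ r.den := by exact_mod_cast hq1
  have htri : ∀ x : ℝ, |x - (r : ℝ)| - |rhoNat m - x| ≤ |rhoNat m - r| := fun x => by
    have h := abs_sub_abs_le_abs_sub (x - r) (x - rhoNat m)
    rw [show (x - (r : ℝ)) - (x - rhoNat m) = rhoNat m - r by ring, abs_sub_comm x (rhoNat m)] at h
    exact h
  by_cases hα : 4 * (r.den : ℝ) ^ 2 ≤ (2 : ℝ) ^ gN m k
  · -- (α) compare with `t_k`
    by_cases hrt : r = tN m k
    · exact Or.inl ⟨k, hrt⟩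
    right; right
    have hsep := one_div_den_mul_den_le_abs_sub (Ne.symm hrt)
    rw [tN_den_cast] at hsep
    have h1 : |rhoNat m - tN m k| < 2 / (2 : ℝ) ^ gN m k := by
      rw [rhoNat_sub_tN hm, abs_of_pos (tailN_pos hm k)]; exact tailN_lt_two_div hm k
    have h2 : 2 / (2 : ℝ) ^ gN m k ≤ 1 / (2 * (r.den : ℝ) ^ 2) := by
      rw [div_le_div_iff₀ (by positivity) (by positivity)]; nlinarith
    have h3 : 1 / ((r.den : ℝ) * r.den) ≤ 1 / ((2 : ℝ) ^ fN m k * r.den) := by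
      apply one_div_le_one_div_of_le (by positivity)
      exact mul_le_mul_of_nonneg_right hQ (by positivity)
    have h4 : 1 / (8 * (r.den : ℝ) ^ 4) ≤ 1 / (2 * (r.den : ℝ) ^ 2) := by
      apply one_div_le_one_div_of_le (by positivity)
      have hq24 : (r.den : ℝ) ^ 2 ≤ (r.den : ℝ) ^ 4 := pow_le_pow_right₀ hqR (by norm_num)
      nlinarith
    have h5 : 1 / ((r.den : ℝ) * r.den) = 2 * (1 / (2 * (r.den : ℝ) ^ 2)) := by
      field_simp
    have h6 := htri (tN m k)
    linarith
  · push Not at hα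
    by_cases hβ : (r.den : ℝ) * (2 : ℝ) ^ gN m k ≤ (2 : ℝ) ^ fN m (k + 1)
    · -- (β) compare with `u_k`
      by_cases hru : r = uN m k
      · exact Or.inr (Or.inl ⟨k, hru⟩)
      right; right
      have hsep := one_div_den_mul_den_le_abs_sub (Ne.symm hru)
      rw [uN_den_cast hm] at hsep
      have hb := uN_sub_rhoNat_bounds hm k
      have hp : (0 : ℝ) < 1 / (2 * (2 : ℝ) ^ fN m (k + 1)) := by positivity
      have h1 : |rhoNat m - uN m k| < 1 / (2 : ℝ) ^ fN m (k + 1) := by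
        rw [abs_sub_comm, abs_of_pos (by linarith [hb.1])]; exact hb.2
      have h2 : 1 / (2 : ℝ) ^ fN m (k + 1) ≤ 1 / ((r.den : ℝ) * (2 : ℝ) ^ gN m k) :=
        one_div_le_one_div_of_le (by positivity) hβ
      have hg : (2 : ℝ) ^ gN m k = 2 * (2 : ℝ) ^ (gN m k - 1) := by
        have e : gN m k = (gN m k - 1) + 1 := by have := fN_add_three_le_gN hm k; omega
        rw [e, pow_succ', Nat.add_sub_cancel]
      have h3 : 1 / ((2 : ℝ) ^ (gN m k - 1) * r.den) = 2 * (1 / ((r.den : ℝ) * (2 : ℝ) ^ gN m k)) := by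
        rw [hg]; field_simp
      have h4 : 1 / (8 * (r.den : ℝ) ^ 4) ≤ 1 / ((r.den : ℝ) * (2 : ℝ) ^ gN m k) := by
        apply one_div_le_one_div_of_le (by positivity)
        have hq34 : (r.den : ℝ) ^ 3 ≤ (r.den : ℝ) ^ 4 := pow_le_pow_right₀ hqR (by norm_num)
        nlinarith [mul_le_mul_of_nonneg_left hα.le (by positivity : (0 : ℝ) ≤ r.den)]
      have h6 := htri (uN m k)
      linarith
    · -- (γ) compare with `t_{k+1}` (`den t_{k+1} = 2^{f_{k+1}} > q`, so `r ≠ t_{k+1}`)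
      push Not at hβ
      right; right
      have hne : tN m (k + 1) ≠ r := by
        intro h
        have hd : (tN m (k + 1)).den = r.den := by rw [h]
        rw [tN_den] at hd
        omega
      have hsep := one_div_den_mul_den_le_abs_sub hne
      rw [tN_den_cast] at hsep
      have h1 : |rhoNat m - tN m (k + 1)| < 2 / (2 : ℝ) ^ gN m (k + 1) := by
        rw [rhoNat_sub_tN hm, abs_of_pos (tailN_pos hm _)]; exact tailN_lt_two_div hm _
      have hgg : (2 : ℝ) ^ (2 * fN m (k + 1) + 2) ≤ (2 : ℝ) ^ gN m (k + 1) :=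
        pow_le_pow_right₀ (by norm_num) (by have := two_fN_add_three_le_gN hm (k + 1); omega)
      have hsq : (2 : ℝ) ^ (2 * fN m (k + 1) + 2) = 4 * ((2 : ℝ) ^ fN m (k + 1)) ^ 2 := by
        rw [pow_add, two_mul, pow_add]; ring
      have hf0 : (0 : ℝ) ≤ (2 : ℝ) ^ fN m (k + 1) := by positivity
      have h2 : 2 / (2 : ℝ) ^ gN m (k + 1) ≤ 1 / (2 * (r.den : ℝ) * (2 : ℝ) ^ fN m (k + 1)) := by
        rw [div_le_div_iff₀ (by positivity) (by positivity)]
        nlinarith [mul_le_mul_of_nonneg_right hQ1.le hf0]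
      have hf3 : (2 : ℝ) ^ fN m (k + 1) ≤ 4 * (r.den : ℝ) ^ 3 := by
        nlinarith [mul_le_mul_of_nonneg_left hα.le (by positivity : (0 : ℝ) ≤ r.den)]
      have h4 : 1 / (8 * (r.den : ℝ) ^ 4) ≤ 1 / (2 * (r.den : ℝ) * (2 : ℝ) ^ fN m (k + 1)) := by
        apply one_div_le_one_div_of_le (by positivity)
        nlinarith [mul_le_mul_of_nonneg_left hf3 (by positivity : (0 : ℝ) ≤ 2 * r.den)]
      have h5 : 1 / ((2 : ℝ) ^ fN m (k + 1) * r.den) = 2 * (1 / (2 * (r.den : ℝ) * (2 : ℝ) ^ fN m (k + 1))) := by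
        field_simp
      have h6 := htri (tN m (k + 1))
      linarith

/-- `(N_k + 1)! < g_k − 1`. -/
theorem factorial_succ_lt_gN_pred {m : ℕ} (hm : 1 ≤ m) (k : ℕ) : (Nn m k + 1)! < gN m k - 1 := by
  unfold gN fN
  rw [Nat.factorial_succ, Nat.add_sub_cancel]
  have h1 : 1 ≤ Nn m k := by have := le_Nn m k; omega
  have h2 : (Nn m k + 1) * ((Nn m k)! + Nn m k) ≤ m * (Nn m k + 1) * ((Nn m k)! + Nn m k) := by
    rw [mul_assoc]; exact Nat.le_mul_of_pos_left _ hm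
  have h3 : (Nn m k + 1) * (Nn m k)! < (Nn m k + 1) * ((Nn m k)! + Nn m k) :=
    Nat.mul_lt_mul_of_pos_left (by omega) (by omega)
  exact lt_of_lt_of_le h3 h2

/-- `g_k − 1 < (m + 1) (N_k + 1)!`. -/
theorem gN_pred_lt (m k : ℕ) : gN m k - 1 < (m + 1) * (Nn m k + 1)! := by
  have eN : Nn m k = (m + 3 + 2 * k) + 1 := by unfold Nn; ring
  unfold gN fN
  rw [Nat.add_sub_cancel, eN]
  set M := m + 3 + 2 * k with hM
  simp only [Nat.factorial_succ]
  have hX : m + 3 ≤ M ! := le_trans (by omega) (Nat.self_le_factorial M)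
  have h1 := Nat.mul_le_mul_left ((M + 1 + 1) * (M + 1)) hX
  nlinarith

/-- **M3 (exact order).** `ρ♮_m ∉ Skel_{m+1}`: by the covering lemma a good approximant is a `t_k` (but
`T_k > 2^{−g_k} ≥ den^{−(m+1)ι}`), a `u_k` (but `|ρ♮ − u_k| > 2^{−f_{k+1}−1} ≥ den^{−(m+1)ι}`, `ι(den u_k) ≥ N_k+2`),
or `≥ 1/(8 den⁴) > den^{−6} ≥ den^{−(m+1)ι}` away. -/
theorem not_skelLiouvilleFix_succ_rhoNat {m : ℕ} (hm : 1 ≤ m) : ¬ SkelLiouvilleFix (m + 1) (rhoNat m) := by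
  intro h
  obtain ⟨r, hq₀, hne, hlt⟩ := h (max 5 (2 ^ fN m 0))
  have hq5 : 5 ≤ r.den := le_trans (le_max_left _ _) hq₀
  have hqf : 2 ^ fN m 0 ≤ r.den := le_trans (le_max_right _ _) hq₀
  rcases rhoNat_cover hm r hqf with ⟨k, rfl⟩ | ⟨k, rfl⟩ | hfar
  · -- `r = t_k`
    rw [rhoNat_sub_tN hm, abs_of_pos (tailN_pos hm k), tN_den, iota_two_pow_fN] at hlt
    push_cast at hlt
    rw [← pow_mul] at hlt
    have h1 := tailN_gt hm k
    have h2 : 1 / (2 : ℝ) ^ (fN m k * ((m + 1) * (Nn m k + 1))) ≤ 1 / (2 : ℝ) ^ gN m k := by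
      apply one_div_le_one_div_of_le (by positivity)
      apply pow_le_pow_right₀ (by norm_num)
      unfold gN
      have := Nn_le_fN m k; have := le_Nn m k
      nlinarith
    linarith
  · -- `r = u_k`
    have hb := uN_sub_rhoNat_bounds hm k
    have hp : (0 : ℝ) < 1 / (2 * (2 : ℝ) ^ fN m (k + 1)) := by positivity
    rw [abs_sub_comm, abs_of_pos (by linarith [hb.1]), uN_den hm] at hlt
    push_cast at hlt
    rw [← pow_mul] at hlt
    have hι2 := iota_two_pow_gN_pred hm k
    have hY : (Nn m k + 1)! + 1 ≤ gN m k - 1 := factorial_succ_lt_gN_pred hm k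
    have h3 : 2 * (Nn m k + 2) * ((Nn m k + 1)! + 1) ≤ (gN m k - 1) * ((m + 1) * (Nn m k + 2)) := by
      have h := Nat.mul_le_mul (Nat.mul_le_mul (show 2 ≤ m + 1 by omega) (le_refl (Nn m k + 2))) hY
      calc 2 * (Nn m k + 2) * ((Nn m k + 1)! + 1) ≤ (m + 1) * (Nn m k + 2) * (gN m k - 1) := h
        _ = (gN m k - 1) * ((m + 1) * (Nn m k + 2)) := by ring
    have h4 : fN m (k + 1) + 1 ≤ 2 * (Nn m k + 2) * ((Nn m k + 1)! + 1) := by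
      unfold fN
      rw [Nn_succ, show Nn m k + 2 = (Nn m k + 1) + 1 from rfl, Nat.factorial_succ (Nn m k + 1)]
      nlinarith [Nat.factorial_pos (Nn m k + 1)]
    have hexp : fN m (k + 1) + 1 ≤ (gN m k - 1) * ((m + 1) * iota (2 ^ (gN m k - 1))) :=
      le_trans h4 (le_trans h3 (Nat.mul_le_mul_left _ (Nat.mul_le_mul_left _ hι2)))
    have h2 : 1 / (2 : ℝ) ^ ((gN m k - 1) * ((m + 1) * iota (2 ^ (gN m k - 1)))) ≤
        1 / (2 * (2 : ℝ) ^ fN m (k + 1)) := by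
      rw [show (2 : ℝ) * (2 : ℝ) ^ fN m (k + 1) = (2 : ℝ) ^ (fN m (k + 1) + 1) by rw [pow_succ']]
      apply one_div_le_one_div_of_le (by positivity)
      exact pow_le_pow_right₀ (by norm_num) hexp
    linarith [hb.1]
  · -- any other rational
    have hqR : (5 : ℝ) ≤ r.den := by exact_mod_cast hq5
    have hι : 2 < iota r.den := lt_iota_of_pow_lt (by norm_num [Nat.factorial]; omega)
    have hexp : 6 ≤ (m + 1) * iota r.den := by nlinarith
    have h2 : 1 / (r.den : ℝ) ^ ((m + 1) * iota r.den) ≤ 1 / (r.den : ℝ) ^ 6 := by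
      apply one_div_le_one_div_of_le (by positivity)
      exact pow_le_pow_right₀ (by linarith) hexp
    have hq2 : (25 : ℝ) ≤ (r.den : ℝ) ^ 2 := by nlinarith
    have hq4 : (0 : ℝ) < (r.den : ℝ) ^ 4 := by positivity
    have h3 : 1 / (r.den : ℝ) ^ 6 < 1 / (8 * (r.den : ℝ) ^ 4) := by
      apply one_div_lt_one_div_of_lt (by positivity)
      nlinarith
    linarith

/-- Hence `ρ♮_m ∉ SkelLiouville` (`= ⋂_m Skel_m`, TREE `skelLiouville_iff_fix`). -/
theorem not_skelLiouville_rhoNat {m : ℕ} (hm : 1 ≤ m) : ¬ SkelLiouville (rhoNat m) := fun h =>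
  not_skelLiouvilleFix_succ_rhoNat hm ((skelLiouville_iff_fix _).1 h (m + 1))

/-- **M4.** `ρ♮_m ∉ FactorialGapLiouville` (TREE `RootDecomp1KGapCell.FactorialGapLiouville`): with
`A := m + 5`, `K := f_0`, a gap witness would be a `t_k` (but `2^{A N!} < 2^{f_k}`, `2^{f_k A} < 2^{(N+1)!}` force
`N = N_k` and then `A N_k! < N_k! + N_k` is absurd), a `u_k` (but `A N! < g_k − 1 < (m+1)(N_k+1)!` and
`(N_k+1)! < g_k − 1 ≤ (g_k − 1) A < (N+1)!` force `N ≤ N_k < N`), or `≥ 1/(8 den⁴) ≥ den^{−A}` away. -/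
theorem not_factorialGapLiouville_rhoNat {m : ℕ} (hm : 1 ≤ m) : ¬ FactorialGapLiouville (rhoNat m) := by
  intro h
  obtain ⟨N, hKN, r, hd1, hd2, hlt⟩ := h (m + 5) (fN m 0)
  have hd1' : 2 ^ ((m + 5) * N !) < r.den := by exact_mod_cast hd1
  have hd2' : r.den ^ (m + 5) < 2 ^ (N + 1)! := by exact_mod_cast hd2
  have hN1 : 1 ≤ N := le_trans (by have := le_Nn m 0; have := Nn_le_fN m 0; omega) hKN
  have hfA : fN m 0 ≤ (m + 5) * N ! :=
    le_trans hKN (le_trans (Nat.self_le_factorial N) (Nat.le_mul_of_pos_left _ (by omega)))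
  have hqf : 2 ^ fN m 0 ≤ r.den := le_of_lt (lt_of_le_of_lt (Nat.pow_le_pow_right two_pos hfA) hd1')
  rcases rhoNat_cover hm r hqf with ⟨k, rfl⟩ | ⟨k, rfl⟩ | hfar
  · -- `r = t_k`
    rw [tN_den] at hd1' hd2'
    rw [← pow_mul] at hd2'
    have h1 : (m + 5) * N ! < fN m k := (Nat.pow_lt_pow_iff_right (by norm_num)).1 hd1'
    have h2 : fN m k * (m + 5) < (N + 1)! := (Nat.pow_lt_pow_iff_right (by norm_num)).1 hd2'
    have hNk : N ≤ Nn m k := by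
      have h3 : N ! < (Nn m k + 1)! :=
        lt_of_lt_of_le (lt_of_le_of_lt (Nat.le_mul_of_pos_left _ (by omega)) h1) (fN_le_factorial_succ m k)
      have := (Nat.factorial_lt (by omega)).mp h3
      omega
    have hkN : Nn m k ≤ N := by
      have h3 : (Nn m k)! < (N + 1)! :=
        lt_of_lt_of_le (factorial_lt_fN m k) ((Nat.le_mul_of_pos_right _ (by omega)).trans h2.le)
      have := (Nat.factorial_lt (by have := le_Nn m k; omega)).mp h3
      omega
    have hEq : N = Nn m k := le_antisymm hNk hkN
    rw [hEq] at h1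
    unfold fN at h1
    have h4 : 2 * (Nn m k)! ≤ (m + 5) * (Nn m k)! := Nat.mul_le_mul_right _ (by omega)
    have h5 := Nat.self_le_factorial (Nn m k)
    omega
  · -- `r = u_k`
    rw [uN_den hm] at hd1' hd2'
    rw [← pow_mul] at hd2'
    have h1 : (m + 5) * N ! < gN m k - 1 := (Nat.pow_lt_pow_iff_right (by norm_num)).1 hd1'
    have h2 : (gN m k - 1) * (m + 5) < (N + 1)! := (Nat.pow_lt_pow_iff_right (by norm_num)).1 hd2'
    have hNk : N ≤ Nn m k := by
      have h3 : (m + 5) * N ! < (m + 5) * (Nn m k + 1)! :=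
        lt_of_lt_of_le (h1.trans (gN_pred_lt m k)) (Nat.mul_le_mul_right _ (by omega))
      have h4 : N ! < (Nn m k + 1)! := Nat.lt_of_mul_lt_mul_left h3
      have := (Nat.factorial_lt (by omega)).mp h4
      omega
    have hkN : Nn m k < N := by
      have h3 : (Nn m k + 1)! < (N + 1)! :=
        lt_of_lt_of_le (factorial_succ_lt_gN_pred hm k) ((Nat.le_mul_of_pos_right _ (by omega)).trans h2.le)
      have := (Nat.factorial_lt (Nat.succ_pos _)).mp h3
      omega
    omega
  · -- any other rational: `den > 2^{A N!} ≥ 8`, so `den^{−A} ≤ den^{−5} ≤ 1/(8 den⁴) ≤ |ρ♮ − r|`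
    have h8 : 8 ≤ r.den := by
      have h3 : 2 ^ 3 ≤ 2 ^ ((m + 5) * N !) :=
        Nat.pow_le_pow_right two_pos (by nlinarith [Nat.factorial_pos N])
      omega
    have hqR : (8 : ℝ) ≤ r.den := by exact_mod_cast h8
    have h2 : 1 / (r.den : ℝ) ^ (m + 5) ≤ 1 / (r.den : ℝ) ^ 5 := by
      apply one_div_le_one_div_of_le (by positivity)
      exact pow_le_pow_right₀ (by linarith) (by omega)
    have hq4 : (0 : ℝ) < (r.den : ℝ) ^ 4 := by positivity
    have h3 : 1 / (r.den : ℝ) ^ 5 ≤ 1 / (8 * (r.den : ℝ) ^ 4) := by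
      apply one_div_le_one_div_of_le (by positivity)
      nlinarith
    linarith

/-- **M5.** `ρ♮_m ∉ LogLogLiouville` (TREE `logLogLiouville_skelLiouville : LogLog → Skel`, `RootDecomp1KSkelCell01`). -/
theorem not_logLogLiouville_rhoNat {m : ℕ} (hm : 1 ≤ m) : ¬ LogLogLiouville (rhoNat m) := fun h =>
  not_skelLiouville_rhoNat hm (logLogLiouville_skelLiouville h)

/-- … hence `∉ LogSqLiouville` (TREE `logLogLiouville_of_logSqLiouville`, `RootDecomp1KLogLogCell01`). -/
theorem not_logSqLiouville_rhoNat {m : ℕ} (hm : 1 ≤ m) : ¬ LogSqLiouville (rhoNat m) := fun h =>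
  not_logLogLiouville_rhoNat hm (logLogLiouville_of_logSqLiouville h)

/-- … hence `∉ LogHyperLiouville` (TREE `logLogLiouville_of_logHyperLiouville`). -/
theorem not_logHyperLiouville_rhoNat {m : ℕ} (hm : 1 ≤ m) : ¬ LogHyperLiouville (rhoNat m) := fun h =>
  not_logLogLiouville_rhoNat hm (logLogLiouville_of_logHyperLiouville h)

/-- … hence `∉ HyperLiouville` (TREE `logLogLiouville_of_hyperLiouville`). -/
theorem not_hyperLiouville_rhoNat {m : ℕ} (hm : 1 ≤ m) : ¬ HyperLiouville (rhoNat m) := fun h =>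
  not_logLogLiouville_rhoNat hm (logLogLiouville_of_hyperLiouville h)

/-- … hence of NO positive exponential order (TREE `RootDecomp1KDarkLogSq.logHyperLiouville_of_liouvilleOrder`). -/
theorem not_liouvilleOrder_rhoNat {m : ℕ} (hm : 1 ≤ m) {k : ℕ} (hk : 1 ≤ k) : ¬ LiouvilleOrder k (rhoNat m) :=
  fun h => not_logHyperLiouville_rhoNat hm (logHyperLiouville_of_liouvilleOrder hk h)

/-- `ρ♮_m` is Liouville (TREE `SkelLiouvilleFix.liouville`). -/
theorem liouville_rhoNat {m : ℕ} (hm : 1 ≤ m) : Liouville (rhoNat m) := (skelLiouvilleFix_rhoNat hm).liouville hm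

/-- The class is NOT contained in any `Skel`-type class: `u⋆ ∈ Skel_1 \ DyadicCollarLiouville` (§2), while
`ρ♮_m ∈ DyadicCollarLiouville \ Skel_{m+1}`; and `DyadicCollarLiouville ⊄ FactorialGap ∪ LogLog ∪ LogSq ∪ LogHyper ∪
Hyper ∪ ⋃_{k ≥ 1} LiouvilleOrder k` (witness `ρ♮_1`). -/
theorem dyadicCollarLiouville_not_subset :
    ∃ ρ : ℝ, DyadicCollarLiouville ρ ∧ ¬ SkelLiouvilleFix 2 ρ ∧ ¬ SkelLiouville ρ ∧ ¬ FactorialGapLiouville ρ ∧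
      ¬ LogLogLiouville ρ ∧ ¬ LogSqLiouville ρ ∧ ¬ LogHyperLiouville ρ ∧ ¬ HyperLiouville ρ ∧
      (∀ k, 1 ≤ k → ¬ LiouvilleOrder k ρ) :=
  ⟨rhoNat 1, dyadicCollarLiouville_rhoNat le_rfl, not_skelLiouvilleFix_succ_rhoNat le_rfl,
    not_skelLiouville_rhoNat le_rfl, not_factorialGapLiouville_rhoNat le_rfl, not_logLogLiouville_rhoNat le_rfl,
    not_logSqLiouville_rhoNat le_rfl, not_logHyperLiouville_rhoNat le_rfl, not_hyperLiouville_rhoNat le_rfl,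
    fun _ hk => not_liouvilleOrder_rhoNat le_rfl hk⟩

end Certificates

end Summit.Schanuel.Schanuel.Theorems.RootDecomp1KCollarCell

end
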